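import Mathlib
import Summits.Ventures.HodgeRepro.Tier4.Target
import Summits.Ventures.HodgeRepro.Tier4.Line3.Defs
import Summits.Ventures.HodgeRepro.Tier4.Line3.LocaliserS
import Summits.Ventures.HodgeRepro.Tier4.Line3.OffMainOrbit
import Summits.Ventures.HodgeRepro.Tier4.Line3.KernelBound
import Summits.Ventures.HodgeRepro.Tier4.Line3.ClassBoundGauss
import Summits.Ventures.HodgeRepro.Tier4.Line3.ClassBoundDef
import Summits.Ventures.HodgeRepro.Tier4.Line3.SupportMass
import Summits.Ventures.HodgeRepro.Tier4.Line3.LatticeGaussDefs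
import Summits.Ventures.HodgeRepro.Tier4.Line3.LatticeEmbedLemmas
import Summits.Ventures.HodgeRepro.Tier4.Line3.LatticeGaussPointwise
import Summits.Ventures.HodgeRepro.Tier4.Line3.LatticeGaussSum

/-!
# Tier4/Line3/SuppMajorantBound — (R2) THE LATTICE GAUSSIAN SUM over the support of the localiser

Blind re-derivation cell `pub-hodge-repro`, Tier 4 «PROVE THE STEP» (README §9–§10), LINE L3, seat t4-x2 (reserve
wall-breaker) on (R2) of L3.5's residual (lead g385 S12860 (R-IV); L2-p1's census S12833: «the support at every depth
lies in the lines of the fixed cosets `xm + L`, `L ∈ S` finite»).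

THE STATEMENT (`exists_suppMajorant_tsum_le`, registered on the bus S12875): for a localiser `ℓ : LocS` and `c₁ > 0`,
`e`, the support-restricted majorant with the definite Gaussians (t4-L2-p3's `suppMajorant`, SupportMass p671078) is
SUMMABLE over the line tuples at every `z ∈ 𝔹` and `Σ_w suppMajorant D ℓ c₁ e N w z ≤ A / (1 − |z|²)^m`, with `A, m`
depending on `(D, ℓ, c₁, e)` only — UNIFORMLY IN THE DEPTH `N`.

PROOF.  (a) `LocS.supp` puts every line tuple of the support in `linesOf L = {lines x : ∀ j, x j ∈ L}` for one of the
finitely many support lattices `L ∈ S` (`(𝔭𝔭̄)^N • L ≤ L`, `xm ∈ L`); (b) the majorant is a function of ANY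
representative (`majorantDefAt_eq_of_lines`: the torus invariance of the per-vector factors), so the sum over `linesOf L`
is at most the sum over the tuples `L⁴` (an INJECTION `w ↦ x_w`, `Summable.tsum_le_tsum_of_inj`), which factors as
`(aNorm₀ + aNorm₁)^4 · (Σ_{v ∈ L} vecFactor c₁ e v z)^4` (`tsum_pi_prod`); (c) the lattice sum is the theta bound of
`LatticeGaussSum.exists_vecFactor_tsum_le`, `≤ A_L / (1 − |z|²)^{m_L}`; (d) the finite sum over `S` and the `aNorm`
factor (`KMDatumS.growth` through `KernelBound.aNorm_le`) give `A / (1 − |z|²)^m` with `m = 4 m_Φ + 4 max_L m_L`.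

Nothing here asserts anything about the truth of (P); HC_CM is NOT proved by anyone in this repository.
-/

set_option autoImplicit false

noncomputable section

namespace Summit.Ventures.HodgeRepro.Tier4.Line3

open Matrix NumberField

/-- **THE PRODUCT OF `n` COPIES OF A NON-NEGATIVE SUMMABLE FAMILY** is summable over `Fin n → ι`, with sum `(Σ φ)^n`. -/
theorem tsum_pi_prod {ι : Type*} (φ : ι → ℝ) (h0 : ∀ v, 0 ≤ φ v) (hs : Summable φ) (n : ℕ) :
    Summable (fun x : Fin n → ι => ∏ j, φ (x j)) ∧ ∑' x : Fin n → ι, ∏ j, φ (x j) = (∑' v, φ v) ^ n := by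
  induction n with
  | zero =>
    refine ⟨?_, ?_⟩
    · exact (hasSum_fintype _).summable
    · simp
  | succ n ih =>
    obtain ⟨ihs, ihe⟩ := ih
    have hprod0 : ∀ y : Fin n → ι, 0 ≤ ∏ j, φ (y j) := fun y => Finset.prod_nonneg fun j _ => h0 _
    -- `Fin (n+1) → ι ≃ ι × (Fin n → ι)`
    let e : ι × (Fin n → ι) ≃ (Fin (n + 1) → ι) := Fin.consEquiv (fun _ => ι)
    have hcomp : ∀ p : ι × (Fin n → ι), (∏ j, φ (e p j)) = φ p.1 * ∏ j, φ (p.2 j) := by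
      intro p
      rw [Fin.prod_univ_succ]
      simp [e, Fin.consEquiv]
    have hφ : (0 : ι → ℝ) ≤ φ := Pi.le_def.mpr h0
    have hprod0' : (0 : (Fin n → ι) → ℝ) ≤ fun y => ∏ j, φ (y j) := Pi.le_def.mpr hprod0
    have hmul : Summable fun p : ι × (Fin n → ι) => φ p.1 * ∏ j, φ (p.2 j) :=
      Summable.mul_of_nonneg (f := φ) (g := fun y : Fin n → ι => ∏ j, φ (y j)) hs ihs hφ hprod0'
    have hsum : Summable (fun x : Fin (n + 1) → ι => ∏ j, φ (x j)) := by
      have hc : Summable ((fun x : Fin (n + 1) → ι => ∏ j, φ (x j)) ∘ e) :=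
        hmul.congr fun p => (hcomp p).symm
      exact e.summable_iff.mp hc
    refine ⟨hsum, ?_⟩
    rw [← e.tsum_eq]
    calc ∑' p : ι × (Fin n → ι), ∏ j, φ (e p j) = ∑' p : ι × (Fin n → ι), φ p.1 * ∏ j, φ (p.2 j) :=
          tsum_congr hcomp
      _ = (∑' v, φ v) * ∑' y : Fin n → ι, ∏ j, φ (y j) := (hs.tsum_mul_tsum ihs hmul).symm
      _ = (∑' v, φ v) ^ (n + 1) := by rw [ihe, pow_succ, mul_comm]

namespace T4Data

variable (X : T4Data)

/-- **THE SUPPORT LIES IN THE FIXED COSETS**: a line tuple with a non-zero localised coefficient at depth `N` is in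
`linesOf L` for one of the support lattices `L ∈ S` (`LocS.supp`). -/
theorem suppSet_subset_linesOf (D : X.ThetaData) {p : IsDedekindDomain.HeightOneSpectrum (RingOfIntegers X.E)}
    {L₀ : Submodule (RingOfIntegers X.E) (Fin 3 → X.E)} {xm : X.Tuple} (ℓ : X.LocS D p L₀ xm)
    (S : Finset (Submodule (RingOfIntegers X.E) (Fin 3 → X.E)))
    (hS : ∀ L ∈ S, X.IsLattice L ∧ ∀ j, xm j ∈ L)
    (hsupp : ∀ N (w : X.LineTuple), X.coefQ D.cf (ℓ.loc N) (X.rep w) ≠ 0 → ∃ x : X.Tuple, X.lines x = w ∧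
      ∃ L ∈ S, ∀ j, x j - xm j ∈ (p.asIdeal * X.conjIdeal p.asIdeal) ^ N • L)
    (N : ℕ) (w : X.LineTuple) (hw : w ∈ X.suppSet D ℓ N) : ∃ L ∈ S, w ∈ X.linesOf L := by
  obtain ⟨x, hxw, L, hL, hx⟩ := hsupp N w hw
  refine ⟨L, hL, x, hxw, fun j => ?_⟩
  have h1 : x j - xm j ∈ L := Submodule.smul_le_right (hx j)
  have h2 : xm j ∈ L := (hS L hL).2 j
  have : x j = (x j - xm j) + xm j := by ring
  rw [this]
  exact L.add_mem h1 h2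

/-- The majorant at the line tuple of `x` is the per-vector product at `x` itself (torus invariance). -/
theorem majorantDefAt_eq_of_lines (c₁ : ℝ) (Φ : KMDatumS) (e : ℝ) (x : X.Tuple) (z : Fin 2 → ℂ) :
    X.majorantDefAt c₁ Φ e (X.lines x) z = (aNorm Φ z 0 + aNorm Φ z 1) ^ 4 * ∏ j, X.vecFactor c₁ e (x j) z := by
  rw [X.majorantDefAt_eq_prod]
  congr 1
  refine Finset.prod_congr rfl fun j _ => ?_
  exact X.vecFactor_of_lineStep c₁ e (X.lineStep_out (x j)) z

/-- The chosen tuple of `L`-vectors represents the line tuple. -/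
theorem lines_tupOf (L : Submodule (RingOfIntegers X.E) (Fin 3 → X.E)) (w : X.linesOf L) :
    X.lines (fun j => (X.tupOf L w j : Fin 3 → X.E)) = w.1 :=
  (Classical.choose_spec w.2).1

/-- Distinct line tuples have distinct chosen tuples. -/
theorem tupOf_injective (L : Submodule (RingOfIntegers X.E) (Fin 3 → X.E)) : Function.Injective (X.tupOf L) := by
  intro w w' h
  apply Subtype.ext
  rw [← X.lines_tupOf L w, ← X.lines_tupOf L w']
  congr 1
  funext j
  exact congrArg Subtype.val (congrFun h j)

/-- **THE SUM OVER THE LINES OF `L⁴`** of the majorant is summable and at most `(aNorm₀ + aNorm₁)^4 (Σ_{v ∈ L} vecFactor)^4`. -/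
theorem tsum_indicator_linesOf_le (c₁ : ℝ) (Φ : KMDatumS) (e : ℝ) (L : Submodule (RingOfIntegers X.E) (Fin 3 → X.E))
    (z : Fin 2 → ℂ) (hsumL : Summable fun v : L => X.vecFactor c₁ e v z) :
    Summable ((X.linesOf L).indicator fun w => X.majorantDefAt c₁ Φ e w z) ∧
      ∑' w, (X.linesOf L).indicator (fun w => X.majorantDefAt c₁ Φ e w z) w ≤
        (aNorm Φ z 0 + aNorm Φ z 1) ^ 4 * (∑' v : L, X.vecFactor c₁ e v z) ^ 4 := by
  obtain ⟨hsumP, htsumP⟩ := tsum_pi_prod (fun v : L => X.vecFactor c₁ e v z)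
    (fun v => X.vecFactor_nonneg _ _ _ _) hsumL 4
  set G : (Fin 4 → L) → ℝ := fun x => (aNorm Φ z 0 + aNorm Φ z 1) ^ 4 * ∏ j, X.vecFactor c₁ e (x j) z with hG
  have hGsum : Summable G := hsumP.mul_left _
  have hG0 : ∀ x, 0 ≤ G x := fun x =>
    mul_nonneg (pow_nonneg (add_nonneg (aNorm_nonneg _ _ _) (aNorm_nonneg _ _ _)) _)
      (Finset.prod_nonneg fun j _ => X.vecFactor_nonneg _ _ _ _)
  have hfw : ∀ w : X.linesOf L, X.majorantDefAt c₁ Φ e w.1 z = G (X.tupOf L w) := by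
    intro w
    rw [← X.lines_tupOf L w, X.majorantDefAt_eq_of_lines]
  have hsub : Summable fun w : X.linesOf L => X.majorantDefAt c₁ Φ e w.1 z := by
    have := hGsum.comp_injective (X.tupOf_injective L)
    exact this.congr fun w => (hfw w).symm
  have hind : Summable ((X.linesOf L).indicator fun w => X.majorantDefAt c₁ Φ e w z) :=
    summable_subtype_iff_indicator.mp hsub
  refine ⟨hind, ?_⟩
  rw [← tsum_subtype]
  calc ∑' w : X.linesOf L, X.majorantDefAt c₁ Φ e w.1 z = ∑' w : X.linesOf L, G (X.tupOf L w) := tsum_congr hfw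
    _ ≤ ∑' x, G x :=
        Summable.tsum_le_tsum_of_inj (X.tupOf L) (X.tupOf_injective L) (fun x _ => hG0 x) (fun w => le_rfl)
          (hsub.congr hfw) hGsum
    _ = (aNorm Φ z 0 + aNorm Φ z 1) ^ 4 * (∑' v : L, X.vecFactor c₁ e v z) ^ 4 := by
        rw [hG, tsum_mul_left, htsumP]

/-- `(1 − |z|²)^{−a}` is monotone in the exponent on the ball: for `a ≤ b`, `1/(1 − |z|²)^a ≤ 1/(1 − |z|²)^b`. -/
theorem div_rpow_le_div_rpow {t A a b : ℝ} (ht : 0 < t) (ht1 : t ≤ 1) (hA : 0 ≤ A) (hab : a ≤ b) :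
    A / t ^ a ≤ A / t ^ b := by
  have hpos : 0 < t ^ b := Real.rpow_pos_of_pos ht _
  have hle : t ^ b ≤ t ^ a := Real.rpow_le_rpow_of_exponent_ge ht ht1 hab
  exact div_le_div_of_nonneg_left hA hpos hle

/-- **(R2) THE LATTICE GAUSSIAN SUM OVER THE SUPPORT** — the registered statement (S12875). -/
theorem exists_suppMajorant_tsum_le (D : X.ThetaData) (p : IsDedekindDomain.HeightOneSpectrum (RingOfIntegers X.E))
    (L₀ : Submodule (RingOfIntegers X.E) (Fin 3 → X.E)) (xm : X.Tuple) (ℓ : X.LocS D p L₀ xm) (c₁ e : ℝ)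
    (hc₁ : 0 < c₁) :
    ∃ A m : ℝ, 0 ≤ A ∧ 0 ≤ m ∧ ∀ (N : ℕ) (z : Fin 2 → ℂ), z ∈ ball →
      Summable (fun w => X.suppMajorant D ℓ c₁ e N w z) ∧
        ∑' w, X.suppMajorant D ℓ c₁ e N w z ≤ A / (1 - nsq z) ^ m := by
  classical
  obtain ⟨S, hS, hsupp⟩ := ℓ.supp
  -- the theta bound for each support lattice
  have hthetaL : ∀ L ∈ S, ∃ A m : ℝ, 0 ≤ A ∧ 0 ≤ m ∧ ∀ z ∈ ball,
      Summable (fun v : L => X.vecFactor c₁ e v z) ∧ ∑' v : L, X.vecFactor c₁ e v z ≤ A / (1 - nsq z) ^ m :=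
    fun L hL => X.exists_vecFactor_tsum_le p (hS L hL).1.1 hc₁ e
  choose! AL mL hAL hmL htheta using hthetaL
  -- the `aNorm` growth of the datum
  obtain ⟨CΦ, mΦ, hCm⟩ := D.Φ.growth
  set C₀ : ℝ := max CΦ 0 with hC₀
  have hC₀0 : 0 ≤ C₀ := le_max_right _ _
  have hCm' : ∀ z ∈ ball, ∀ k i j, ‖D.Φ.A z k i j‖ ≤ C₀ / (1 - nsq z) ^ mΦ := by
    intro z hz k i j
    refine (hCm z hz k i j).trans ?_
    have hpos : 0 < (1 - nsq z) ^ mΦ := by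
      have : nsq z < 1 := hz
      exact Real.rpow_pos_of_pos (by linarith) _
    exact div_le_div_of_nonneg_right (le_max_left _ _) hpos.le
  set mΦ' : ℝ := max mΦ 0 with hmΦ'
  have hmΦ'0 : 0 ≤ mΦ' := le_max_right _ _
  set mS : ℝ := ∑ L ∈ S, mL L with hmS
  have hmS0 : 0 ≤ mS := Finset.sum_nonneg fun L hL => hmL L hL
  have hmL_le : ∀ L ∈ S, mL L ≤ mS := fun L hL =>
    Finset.single_le_sum (f := mL) (fun L' hL' => hmL L' hL') hL
  refine ⟨∑ L ∈ S, (18 * C₀) ^ 4 * AL L ^ 4, mΦ' * 4 + mS * 4, ?_, ?_, fun N z hz => ?_⟩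
  · exact Finset.sum_nonneg fun L hL => mul_nonneg (by positivity) (pow_nonneg (hAL L hL) _)
  · positivity
  have hz1 : nsq z < 1 := hz
  have ht : 0 < 1 - nsq z := by linarith
  have ht1 : 1 - nsq z ≤ 1 := by
    have : 0 ≤ nsq z := by unfold nsq; positivity
    linarith
  -- per support lattice: summable, and bounded by `(18 C₀)^4 A_L^4 / t^m`
  have hper : ∀ L ∈ S, Summable ((X.linesOf L).indicator fun w => X.majorantDefAt c₁ D.Φ e w z) ∧
      ∑' w, (X.linesOf L).indicator (fun w => X.majorantDefAt c₁ D.Φ e w z) w ≤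
        (18 * C₀) ^ 4 * AL L ^ 4 / (1 - nsq z) ^ (mΦ' * 4 + mS * 4) := by
    intro L hL
    obtain ⟨hsumL, hboundL⟩ := htheta L hL z hz
    obtain ⟨hind, hle⟩ := X.tsum_indicator_linesOf_le c₁ D.Φ e L z hsumL
    refine ⟨hind, hle.trans ?_⟩
    have ha : aNorm D.Φ z 0 + aNorm D.Φ z 1 ≤ 18 * (C₀ / (1 - nsq z) ^ mΦ') := by
      have h0 := aNorm_le D.Φ z hz 0 hCm'
      have h1 := aNorm_le D.Φ z hz 1 hCm'
      have hm : C₀ / (1 - nsq z) ^ mΦ ≤ C₀ / (1 - nsq z) ^ mΦ' :=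
        div_rpow_le_div_rpow ht ht1 hC₀0 (le_max_left _ _)
      linarith
    have hs : ∑' v : L, X.vecFactor c₁ e v z ≤ AL L / (1 - nsq z) ^ mS :=
      hboundL.trans (div_rpow_le_div_rpow ht ht1 (hAL L hL) (hmL_le L hL))
    have hsum0 : 0 ≤ ∑' v : L, X.vecFactor c₁ e v z := tsum_nonneg fun v => X.vecFactor_nonneg _ _ _ _
    have ha0 : 0 ≤ aNorm D.Φ z 0 + aNorm D.Φ z 1 := add_nonneg (aNorm_nonneg _ _ _) (aNorm_nonneg _ _ _)
    have hd0 : 0 ≤ 18 * (C₀ / (1 - nsq z) ^ mΦ') := by positivity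
    calc (aNorm D.Φ z 0 + aNorm D.Φ z 1) ^ 4 * (∑' v : L, X.vecFactor c₁ e v z) ^ 4
        ≤ (18 * (C₀ / (1 - nsq z) ^ mΦ')) ^ 4 * (AL L / (1 - nsq z) ^ mS) ^ 4 :=
          mul_le_mul (pow_le_pow_left₀ ha0 ha 4) (pow_le_pow_left₀ hsum0 hs 4) (pow_nonneg hsum0 _)
            (pow_nonneg hd0 _)
      _ = (18 * C₀) ^ 4 * AL L ^ 4 / (1 - nsq z) ^ (mΦ' * 4 + mS * 4) := by
          rw [← mul_div_assoc, div_pow, div_pow, ← Real.rpow_natCast ((1 - nsq z) ^ mΦ') 4,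
            ← Real.rpow_natCast ((1 - nsq z) ^ mS) 4, ← Real.rpow_mul ht.le, ← Real.rpow_mul ht.le,
            Real.rpow_add ht]
          push_cast
          rw [div_mul_div_comm]
  -- the pointwise bound of the support majorant by the finite sum over the support lattices
  have hpt : ∀ w, X.suppMajorant D ℓ c₁ e N w z ≤
      ∑ L ∈ S, (X.linesOf L).indicator (fun w => X.majorantDefAt c₁ D.Φ e w z) w := by
    intro w
    unfold suppMajorant
    by_cases hw : w ∈ X.suppSet D ℓ N
    · rw [Set.indicator_of_mem hw]
      obtain ⟨L, hL, hwL⟩ := X.suppSet_subset_linesOf D ℓ S hS hsupp N w hw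
      calc X.majorantDefAt c₁ D.Φ e w z
          = (X.linesOf L).indicator (fun w => X.majorantDefAt c₁ D.Φ e w z) w :=
            (Set.indicator_of_mem hwL (fun w => X.majorantDefAt c₁ D.Φ e w z)).symm
        _ ≤ ∑ L' ∈ S, (X.linesOf L').indicator (fun w => X.majorantDefAt c₁ D.Φ e w z) w :=
          Finset.single_le_sum
            (f := fun L' => (X.linesOf L').indicator (fun w => X.majorantDefAt c₁ D.Φ e w z) w)
            (fun L' _ => Set.indicator_nonneg (fun _ _ => X.majorantDefAt_nonneg _ _ _ _ _) _) hL
    · rw [Set.indicator_of_notMem hw]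
      exact Finset.sum_nonneg fun L' _ => Set.indicator_nonneg (fun _ _ => X.majorantDefAt_nonneg _ _ _ _ _) _
  have hsumS : Summable fun w => ∑ L ∈ S, (X.linesOf L).indicator (fun w => X.majorantDefAt c₁ D.Φ e w z) w :=
    summable_sum fun L hL => (hper L hL).1
  have hsum : Summable fun w => X.suppMajorant D ℓ c₁ e N w z :=
    Summable.of_nonneg_of_le (fun w => X.suppMajorant_nonneg D ℓ c₁ e N w z) hpt hsumS
  refine ⟨hsum, ?_⟩
  calc ∑' w, X.suppMajorant D ℓ c₁ e N w z
      ≤ ∑' w, ∑ L ∈ S, (X.linesOf L).indicator (fun w => X.majorantDefAt c₁ D.Φ e w z) w :=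
        Summable.tsum_le_tsum hpt hsum hsumS
    _ = ∑ L ∈ S, ∑' w, (X.linesOf L).indicator (fun w => X.majorantDefAt c₁ D.Φ e w z) w :=
        Summable.tsum_finsetSum fun L hL => (hper L hL).1
    _ ≤ ∑ L ∈ S, (18 * C₀) ^ 4 * AL L ^ 4 / (1 - nsq z) ^ (mΦ' * 4 + mS * 4) :=
        Finset.sum_le_sum fun L hL => (hper L hL).2
    _ = (∑ L ∈ S, (18 * C₀) ^ 4 * AL L ^ 4) / (1 - nsq z) ^ (mΦ' * 4 + mS * 4) := by rw [Finset.sum_div]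

end T4Data

end Summit.Ventures.HodgeRepro.Tier4.Line3

end
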